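import Summits.Ventures.PercRepro.ProfileGapMonoThresholdWeakAvgZeroFull

/-!
# PercRepro — THE SHARES OF THE STRONG AVERAGED STEP AT CO-RANK `2`: validity with an arbitrary weight, and the
supply bounds for the weight `g_t(S) = #S − 2 + [ρ(E∖S) = t] κ(E∖S)` (p5, gen 28; `proofs/P5-GM1.md` §31(b))

The strong averaged step `Σ_z Φ_t(N ∖ z) ≤ (#E − q) Φ_t(N)` (p10's `AvgStepT`) is the weak one minus `q Φ_t(N)`: at
co-rank `2` its supply is `Σ_{S ∈ T_t} 2 g_t(S)` with `g_t(S) = #S − 2 + [ρ(E∖S) = t] κ(E∖S)` — a PAIR weighs its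
deaths only.  The charging of `ProfileGapMonoThresholdWeakAvgShare` / `WeakAvgSupply` never looks at the weight:
* `sum_share_le_sum_weight_wt` — VALIDITY of the half / whole shares for ANY weight `g : Finset α → ℕ`;
* `sum_g_insert_ge` — the half-weights `g_t` of the up-sets of `B` sum to at least
  `#Y (#B − 1) + [ρ(E∖B) = t + 1] (κ − 1) · #(K ∖ P)`;
* `supply_ge_sum_g`, `supply_eq_two_mul_of_two_le_g` — the supply against the half-weights;
* `supply_ge_singleton_big_g` — a singleton of a class with `≥ 2` points at `ρ(E∖b) = t + 1` takes the whole
  `2 g_t({b, y}) ≥ 2 (κ − 1)` from every coloop `y` of `E ∖ b` outside the class.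
-/

open scoped Matroid

namespace PercRepro.Cogirth

open Finset ThmH Skew Shadow Profile

variable {α : Type} [DecidableEq α] {N : Matroid α} [N.Finite]

section Validity

/-- **Validity of the shares for an arbitrary weight** `g`: summed over the rank-`1` sets with `ρ(E∖B) ≥ t + 1`, the
half / whole shares of the up-sets never exceed `Σ_{S ∈ T_t} 2 g(S)`. -/
theorem sum_share_le_sum_weight_wt (hloop : ∀ x ∈ gr N, rk N {x} = 1) (t : ℕ) (g : Finset α → ℕ) :
    ∑ B ∈ (Rq N 1).filter (fun B => t + 1 ≤ rk N (gr N \ B)), ∑ y ∈ gr N \ clF N B,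
        (if B.card = 1 ∧ t + 1 ≤ rk N (gr N \ {y}) then 1 else 2) * g (insert y B) ≤
      ∑ S ∈ levelSetCoQ N t 2, 2 * g S := by
  set L := (Rq N 1).filter (fun B => t + 1 ≤ rk N (gr N \ B)) with hL
  set Q := L.sigma (fun B => gr N \ clF N B) with hQ
  rw [← sum_sigma L (fun B => gr N \ clF N B)
    (fun p => (if p.1.card = 1 ∧ t + 1 ≤ rk N (gr N \ {p.2}) then 1 else 2) * g (insert p.2 p.1))]
  have hmaps : ∀ p ∈ Q, insert p.2 p.1 ∈ levelSetCoQ N t 2 := by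
    rintro ⟨B, y⟩ hp
    rw [hQ, mem_sigma, hL, mem_filter] at hp
    exact insert_mem_levelSetCoQ_of_rankOne_gen hp.1.1 hp.1.2 hp.2
  rw [← sum_fiberwise_of_maps_to hmaps]
  apply sum_le_sum
  intro S _
  rw [sum_congr rfl (fun p hp => by rw [(mem_filter.1 hp).2]), ← sum_mul]
  apply Nat.mul_le_mul_right
  exact sum_mult_fibre_le_two_gen hloop t S

end Validity

section Supply

/-- The half-weights `g_t` of the up-sets of `B`, summed over the points outside the class, are at least
`(#B − 1) #Y + [ρ(E∖B) = t + 1] (κ − 1) · #{coloops of E ∖ B outside the class}`. -/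
theorem sum_g_insert_ge {B : Finset α} (hB : B ∈ Rq N 1) (t : ℕ) :
    (gr N \ clF N B).card * (B.card - 1) +
      (if rk N (gr N \ B) = t + 1 then
        ((coloops N (gr N \ B)).card - 1) * ((coloops N (gr N \ B)).filter (fun y => y ∉ clF N B)).card
      else 0) ≤
    ∑ y ∈ gr N \ clF N B,
      ((insert y B).card - 2 +
        (if rk N (gr N \ insert y B) = t then (coloops N (gr N \ insert y B)).card else 0)) := by
  have hBg : B ⊆ gr N := (mem_Rq.1 hB).1
  have hX : gr N \ B ⊆ gr N := sdiff_subset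
  have hterm : ∀ y ∈ gr N \ clF N B,
      (insert y B).card - 2 +
          (if rk N (gr N \ insert y B) = t then (coloops N (gr N \ insert y B)).card else 0) =
        (B.card - 1) + (if rk N ((gr N \ B).erase y) = t then (coloops N ((gr N \ B).erase y)).card else 0) := by
    intro y hy
    rw [card_insert_of_notMem (notMem_of_mem_sdiff_clF hBg hy), sdiff_insert_eq_erase]
    congr 1
  rw [sum_congr rfl hterm, sum_add_distrib, sum_const, smul_eq_mul]
  apply Nat.add_le_add_left
  set F := (coloops N (gr N \ B)).filter (fun y => y ∉ clF N B) with hF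
  have hFY : F ⊆ gr N \ clF N B := by
    intro y hy
    rw [hF, mem_filter] at hy
    exact mem_sdiff.2 ⟨hX (coloops_subset _ hy.1), hy.2⟩
  calc (if rk N (gr N \ B) = t + 1 then ((coloops N (gr N \ B)).card - 1) * F.card else 0)
      ≤ ∑ y ∈ F, (if rk N ((gr N \ B).erase y) = t then (coloops N ((gr N \ B).erase y)).card else 0) := by
        split_ifs with h4
        · rw [mul_comm, ← smul_eq_mul, ← sum_const]
          apply sum_le_sum
          intro y hy
          rw [hF, mem_filter] at hy
          have hr := rk_erase_of_mem_coloops hX hy.1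
          rw [if_pos (by omega)]
          have := card_le_card (coloops_erase_subset_coloops_erase hX hy.1)
          rw [card_erase_of_mem hy.1] at this
          exact this
        · exact Nat.zero_le _
    _ ≤ ∑ y ∈ gr N \ clF N B,
          (if rk N ((gr N \ B).erase y) = t then (coloops N ((gr N \ B).erase y)).card else 0) :=
        sum_le_sum_of_subset_of_nonneg hFY (fun _ _ _ => Nat.zero_le _)

/-- The supply of `B` (weight `g_t`) is at least the sum of the half-weights. -/
theorem supply_ge_sum_g (B : Finset α) (t : ℕ) :
    ∑ y ∈ gr N \ clF N B,
        ((insert y B).card - 2 +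
          (if rk N (gr N \ insert y B) = t then (coloops N (gr N \ insert y B)).card else 0)) ≤
      ∑ y ∈ gr N \ clF N B,
        (if B.card = 1 ∧ t + 1 ≤ rk N (gr N \ {y}) then 1 else 2) *
          ((insert y B).card - 2 +
            (if rk N (gr N \ insert y B) = t then (coloops N (gr N \ insert y B)).card else 0)) := by
  apply sum_le_sum
  intro y _
  split_ifs <;> omega

/-- The supply of a set with at least two points is twice the sum of the half-weights. -/
theorem supply_eq_two_mul_of_two_le_g {B : Finset α} (h2 : 2 ≤ B.card) (t : ℕ) :
    2 * ∑ y ∈ gr N \ clF N B,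
        ((insert y B).card - 2 +
          (if rk N (gr N \ insert y B) = t then (coloops N (gr N \ insert y B)).card else 0)) =
      ∑ y ∈ gr N \ clF N B,
        (if B.card = 1 ∧ t + 1 ≤ rk N (gr N \ {y}) then 1 else 2) *
          ((insert y B).card - 2 +
            (if rk N (gr N \ insert y B) = t then (coloops N (gr N \ insert y B)).card else 0)) := by
  rw [mul_sum]
  refine sum_congr rfl (fun y _ => ?_)
  rw [if_neg (show ¬ (B.card = 1 ∧ t + 1 ≤ rk N (gr N \ {y})) from fun h => by have := h.1; omega)]

/-- **A singleton of a big class at `ρ(E∖b) = t + 1`, weight `g_t`**: every coloop `y` of `E ∖ b` outside the class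
has `ρ(E∖y) = t` (the partner of `b` spans `b`), so `{b, y}` has one claimant and `b` takes its whole weight
`2 g_t({b, y}) = 2 κ(E∖{b,y}) ≥ 2 (κ − 1)`: the supply is at least `2 (κ − 1) · #{coloops outside the class}`. -/
theorem supply_ge_singleton_big_g (hloop : ∀ x ∈ gr N, rk N {x} = 1) {b : α} (hb : b ∈ gr N)
    (hP : 2 ≤ (clF N {b}).card) {t : ℕ} (h4 : rk N (gr N \ {b}) = t + 1) :
    2 * ((coloops N (gr N \ {b})).card - 1) *
        ((coloops N (gr N \ {b})).filter (fun y => y ∉ clF N {b})).card ≤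
    ∑ y ∈ gr N \ clF N {b},
      (if ({b} : Finset α).card = 1 ∧ t + 1 ≤ rk N (gr N \ {y}) then 1 else 2) *
        ((insert y ({b} : Finset α)).card - 2 +
          (if rk N (gr N \ insert y {b}) = t then (coloops N (gr N \ insert y {b})).card else 0)) := by
  have hbg : ({b} : Finset α) ⊆ gr N := singleton_subset_iff.2 hb
  have h1 : rk N {b} = 1 := hloop b hb
  have hX : gr N \ {b} ⊆ gr N := sdiff_subset
  set F := (coloops N (gr N \ {b})).filter (fun y => y ∉ clF N {b}) with hF
  have hFY : F ⊆ gr N \ clF N {b} := by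
    intro y hy
    rw [hF, mem_filter] at hy
    exact mem_sdiff.2 ⟨hX (coloops_subset _ hy.1), hy.2⟩
  obtain ⟨b', hb'P, hb'b⟩ : ∃ b' ∈ clF N {b}, b' ≠ b := by
    have : 1 < (clF N {b}).card := by omega
    exact exists_mem_ne this b
  have hb'g : b' ∈ gr N := clF_subset_gr _ hb'P
  have hbb' : b ∈ clF N {b'} :=
    mem_clF_singleton_of_mem_clF hloop h1 (subset_clF hbg (mem_singleton_self b)) hb'P
  -- the share of every `y ∈ F` is the full weight `2 κ(E∖{b,y}) ≥ 2 (κ − 1)`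
  have hfull : ∀ y ∈ F,
      2 * ((coloops N (gr N \ {b})).card - 1) ≤
        (if ({b} : Finset α).card = 1 ∧ t + 1 ≤ rk N (gr N \ {y}) then 1 else 2) *
          ((insert y ({b} : Finset α)).card - 2 +
            (if rk N (gr N \ insert y {b}) = t then (coloops N (gr N \ insert y {b})).card else 0)) := by
    intro y hy
    rw [hF, mem_filter] at hy
    have hyX : y ∈ gr N \ {b} := coloops_subset _ hy.1
    have hyg : y ∈ gr N := hX hyX
    have hyb : y ≠ b := fun h => (mem_sdiff.1 hyX).2 (by rw [h]; exact mem_singleton_self b)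
    have hyb' : y ≠ b' := fun h => hy.2 (by rw [h]; exact hb'P)
    have hr3 : rk N ((gr N \ {b}).erase y) = t := by
      have := rk_erase_of_mem_coloops hX hy.1
      omega
    have hEy : gr N \ {y} = insert b ((gr N \ {b}).erase y) := by
      ext x
      simp only [mem_sdiff, mem_singleton, mem_insert, mem_erase]
      constructor
      · rintro ⟨hx, hxy⟩
        by_cases hxb : x = b
        · exact Or.inl hxb
        · exact Or.inr ⟨hxy, hx, hxb⟩
      · rintro (rfl | ⟨hxy, hx, _⟩)
        · exact ⟨hb, fun h => hyb h.symm⟩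
        · exact ⟨hx, hxy⟩
    have hb'X : b' ∈ (gr N \ {b}).erase y :=
      mem_erase.2 ⟨fun h => hyb' h.symm, mem_sdiff.2 ⟨hb'g, by rwa [mem_singleton]⟩⟩
    have hrEy : rk N (gr N \ {y}) = t := by
      rw [hEy, rk_insert_of_mem_clF_singleton hb hbb' ((erase_subset _ _).trans hX) hb'X, hr3]
    rw [if_neg (fun h => by omega), card_insert_of_notMem (by rwa [mem_singleton]), card_singleton,
      sdiff_insert_eq_erase, if_pos hr3]
    have := card_le_card (coloops_erase_subset_coloops_erase hX hy.1)
    rw [card_erase_of_mem hy.1] at this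
    omega
  rw [← sum_sdiff hFY]
  have hB := sum_le_sum hfull
  rw [sum_const, smul_eq_mul] at hB
  have hA : 0 ≤ ∑ y ∈ (gr N \ clF N {b}) \ F,
      (if ({b} : Finset α).card = 1 ∧ t + 1 ≤ rk N (gr N \ {y}) then 1 else 2) *
        ((insert y ({b} : Finset α)).card - 2 +
          (if rk N (gr N \ insert y {b}) = t then (coloops N (gr N \ insert y {b})).card else 0)) :=
    Nat.zero_le _
  rw [show 2 * ((coloops N (gr N \ {b})).card - 1) * F.card = F.card * (2 * ((coloops N (gr N \ {b})).card - 1))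
    by ring]
  omega

end Supply

end PercRepro.Cogirth
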